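import Mathlib
import Literature.NumberTheory.Transcendental.KZCalculusProofs
import Literature.NumberTheory.Transcendental.SemialgebraicMapsProofs
import Literature.NumberTheory.Transcendental.KZSemialgebraicComplex
import HarnessLib

/-!
# Route `RootDecompQuadraticDescent` (crux `DescentTwoQ`, stmt-KontsevichZagierPeriods-28994), lineage
`decomp-kz-lens-6` g11, piece P4: Zagier's ray representation of `D(z)` is ONE AFFINE MOVE away from a
`ℚ`-RATIONAL two-dimensional representation

For real algebraic `a`, `b` with `b > 0` put `N = a² + b²` (`= |z|²`, `z = a + ib`).  Zagier's ray
representation `KZ.rayDilogRep a b` of the Bloch–Wigner value `D(z)` (coordinates `(s, u)`, domain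
`KZ.rayDilogDomain a b = {0 < s < 1, u strictly between 1 and N s²}`, integrand
`sgn(u − 1)·(−b)/(2u((1 − as)² + (bs)²))`) is NOT of Kontsevich–Zagier's literal rational shape when
`b ∉ ℚ` (e.g. `z = e^{iθ₇} = (−3 + √−7)/4`: an overall factor `√7`).  The single affine substitution

  `τ = (N s − a)/b`,  i.e.  `Φ(s, u) = ((N s − a)/b, u)`,  `|det DΦ| = N/b`,

uses `N((1 − as)² + (bs)²) = b²(1 + τ²) ` (`|1 − sz|² = |z|²·|s − z̄/N|²`) and turns the integrand into
the PARAMETER-FREE rational function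

  `affIntegrand (τ, u) = sgn(u − 1)·(−1)/(2u(1 + τ²))`,

on the domain `affDomain a b = {0 < a + bτ < N, u strictly between 1 and (a + bτ)²/N}` (all the
dependence on `z` is in the domain, which is `ℚ`-semialgebraic because `a`, `b` are algebraic).  Main results:

* `rayAffine` — for algebraic `a`, `b`, `b > 0`: a representation `[affDomain a b, affIntegrand]` EXISTS and EVERY
  such representation is KZ-equivalent to `KZ.rayDilogRep a b` (one instance of rule (2)).
* `isRational_of_affDomain` — if moreover `N ≤ 1` (in particular on the unit circle), every representation
  `[affDomain a b, affIntegrand]` `IsRational`: the sheet `u > 1` is empty and the integrand is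
  `1/(2u(1 + τ²)) = aeval 1 / aeval (2·X₁·(1 + X₀²))` on the domain.

Consequently (with the tree's Milnor bridge `milnorBridge : [T(z), t⁻³] ∼ KZ.rayDilogRep z.re z.im`, route
HyperbolicBloch) every Bloch–Wigner value `D(z)`, `z ∈ ℚ̄`, `|z| ≤ 1`, is the value of a `ℚ`-RATIONAL representation
of dimension `2` KZ-equivalent to the ideal tetrahedron `T(z)`; for `|z| = 1` this is the currency bridge from
hyperbolic/tetrahedral classes to the Clausen classes `Cl₂(θ)` of the weight-2 box (NODE g11 §11.3 P4), used for
Zagier's `Z₇` relation (`Z7TetraKZ.lean`).  The template of the proof is the tree's `stub_rayScale`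
(`Theorems/HyperbolicBlochOffTetraSectorKernelStubRayScale.lean`).

References: D. Zagier, *The dilogarithm function* (2007), Ch. I §3; M. Kontsevich, D. Zagier, *Periods* (2001),
§1.1 ("one can replace 'rational' by 'algebraic' … by introducing more variables" — here no extra variable is
needed), §1.2 rule (2).
-/

noncomputable section

open Set MeasureTheory MvPolynomial
open Literature.NumberTheory.Transcendental
open Literature.ModelTheory.ExponentialFields (IsSemialgebraic isSemialgebraic_setOf_eval_lt)

namespace Summit.KontsevichZagierPeriods.RootDecompQuadraticDescent.RayAffine

/-! ## The target representation data -/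

/-- The affine image of Zagier's ray domain: `0 < a + bτ < N` and `u` strictly between `1` and
`(a + bτ)²/N`, `N = a² + b²`. [cite: Zagier2007Dilogarithm, Ch. I §3] -/
def affDomain (a b : ℝ) : Set (Fin 2 → ℝ) :=
  {w | 0 < a + b * w 0 ∧ a + b * w 0 < a ^ 2 + b ^ 2 ∧
    ((1 < w 1 ∧ (a ^ 2 + b ^ 2) * w 1 < (a + b * w 0) ^ 2) ∨
      ((a + b * w 0) ^ 2 < (a ^ 2 + b ^ 2) * w 1 ∧ w 1 < 1))}

/-- The parameter-free rational integrand `sgn(u − 1)·(−1)/(2u(1 + τ²))`. [folklore] -/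
def affIntegrand (w : Fin 2 → ℝ) : ℝ :=
  (if 1 < w 1 then (1 : ℝ) else -1) * (-1) / (2 * w 1 * (1 + w 0 ^ 2))

variable {a b : ℝ}

/-! ## Zagier's ray data (verbatim copies of `KZ.rayDilogDomain`, `KZ.rayDilogIntegrand` of
`Literature/…/KZRayDilog.lean`, so that this file elaborates against `KZCalculusProofs` alone; at composition
time `KZ.rayDilogRep a b ha hb` satisfies the two clauses by `rfl`) -/

/-- Zagier's ray domain `{0 < s < 1, u strictly between 1 and s²(a² + b²)}` (= `KZ.rayDilogDomain a b`).
[cite: Zagier2007Dilogarithm, Ch. I §3] -/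
def rayDom (a b : ℝ) : Set (Fin 2 → ℝ) :=
  {w | 0 < w 0 ∧ w 0 < 1 ∧ ((1 < w 1 ∧ w 1 < w 0 ^ 2 * (a ^ 2 + b ^ 2)) ∨
    (w 0 ^ 2 * (a ^ 2 + b ^ 2) < w 1 ∧ w 1 < 1))}

/-- Zagier's ray integrand `sgn(u − 1)·(−b)/(2u((1 − sa)² + (sb)²))` (= `KZ.rayDilogIntegrand a b`).
[cite: Zagier2007Dilogarithm, Ch. I §3] -/
def rayInt (a b : ℝ) (w : Fin 2 → ℝ) : ℝ :=
  (if 1 < w 1 then (1 : ℝ) else -1) * (-b) / (2 * w 1 * ((1 - w 0 * a) ^ 2 + (w 0 * b) ^ 2))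

/-- Points of the ray domain have positive second coordinate. [folklore] -/
theorem pos_of_mem_rayDom {a b : ℝ} {w : Fin 2 → ℝ} (hw : w ∈ rayDom a b) : 0 < w 1 := by
  rcases hw.2.2 with h | h
  · exact zero_lt_one.trans h.1
  · exact lt_of_le_of_lt (by positivity) h.1

/-- For `b ≠ 0` the denominator `(1 − sa)² + (sb)²` is positive. [folklore] -/
theorem ray_den_pos {a b : ℝ} (hb : b ≠ 0) (s : ℝ) : 0 < (1 - s * a) ^ 2 + (s * b) ^ 2 := by
  rcases eq_or_ne s 0 with rfl | hs
  · norm_num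
  · have : 0 < (s * b) ^ 2 := by positivity
    nlinarith [sq_nonneg (1 - s * a)]

/-- The sign factor `sgn(u − 1)` is a `ℚ`-semialgebraic function on `ℝ²` (two constants glued along
`{1 < u}` and its complement; copy of `KZ.isSemialgebraicFunOn_rayDilogSign`). [folklore] -/
private theorem sign_isSemialgebraicFunOn :
    IsSemialgebraicFunOn ℚ (univ : Set (Fin 2 → ℝ)) (fun w => if 1 < w 1 then (1 : ℝ) else -1) := by
  have hP1 : IsSemialgebraic ℚ {w : Fin 2 → ℝ | 1 < w 1} := by
    simpa using isSemialgebraic_setOf_eval_lt (k := ℚ) (R := ℝ) 1 (X 1 : MvPolynomial (Fin 2) ℚ)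
  have hf : IsSemialgebraicFunOn ℚ {w : Fin 2 → ℝ | 1 < w 1} (fun _ => (1 : ℝ)) := by
    simpa using isSemialgebraicFunOn_natCast hP1 1
  have hg : IsSemialgebraicFunOn ℚ {w : Fin 2 → ℝ | 1 < w 1}ᶜ (fun _ => (-1 : ℝ)) :=
    (isSemialgebraicFunOn_natCast hP1.compl 1).neg.congr fun w _ => by simp
  have h := IsSemialgebraicFunOn.union hf hg (F := fun w => if 1 < w 1 then (1 : ℝ) else -1)
    (fun w hw => by simp only [mem_setOf_eq] at hw; simp [hw])
    (fun w hw => by simp only [mem_compl_iff, mem_setOf_eq] at hw; simp [hw])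
  rwa [union_compl_self] at h

/-! ## Algebra of the substitution -/

/-- Coordinates of `Φ(s, u) = ((N s − a)/b, u)`. [folklore] -/
theorem aff_apply (Φ : (Fin 2 → ℝ) → (Fin 2 → ℝ))
    (hΦ : ∀ w, Φ w = ![((a ^ 2 + b ^ 2) * w 0 - a) / b, w 1]) (w : Fin 2 → ℝ) :
    Φ w 0 = ((a ^ 2 + b ^ 2) * w 0 - a) / b ∧ Φ w 1 = w 1 := by
  rw [hΦ]
  simp

/-- `a + b·τ = N s` for `τ = (N s − a)/b`. [folklore] -/
theorem aff_lin (hb : b ≠ 0) (s : ℝ) : a + b * (((a ^ 2 + b ^ 2) * s - a) / b) = (a ^ 2 + b ^ 2) * s := by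
  field_simp
  ring

/-- **The image of the ray domain under the substitution is `affDomain a b`.** [folklore] -/
theorem aff_image (Φ : (Fin 2 → ℝ) → (Fin 2 → ℝ))
    (hΦ : ∀ w, Φ w = ![((a ^ 2 + b ^ 2) * w 0 - a) / b, w 1]) (hb : 0 < b) :
    Φ '' rayDom a b = affDomain a b := by
  have hN : 0 < a ^ 2 + b ^ 2 := by positivity
  have hb' : b ≠ 0 := hb.ne'
  ext w
  constructor
  · rintro ⟨x, ⟨h0, h1, hsh⟩, rfl⟩
    obtain ⟨e0, e1⟩ := aff_apply Φ hΦ x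
    simp only [affDomain, mem_setOf_eq, e0, e1, aff_lin hb']
    refine ⟨mul_pos hN h0, by nlinarith, ?_⟩
    rcases hsh with ⟨hu1, huV⟩ | ⟨hVu, hu1⟩
    · exact Or.inl ⟨hu1, by nlinarith⟩
    · exact Or.inr ⟨by nlinarith, hu1⟩
  · rintro ⟨h0, h1, hsh⟩
    refine ⟨![(a + b * w 0) / (a ^ 2 + b ^ 2), w 1], ?_, ?_⟩
    · simp only [rayDom, mem_setOf_eq, Matrix.cons_val_zero, Matrix.cons_val_one,
        Matrix.cons_val_fin_one]
      have hs : ((a + b * w 0) / (a ^ 2 + b ^ 2)) ^ 2 * (a ^ 2 + b ^ 2) =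
          (a + b * w 0) ^ 2 / (a ^ 2 + b ^ 2) := by
        field_simp
      refine ⟨div_pos h0 hN, (div_lt_one hN).mpr h1, ?_⟩
      rw [hs]
      rcases hsh with ⟨hu1, hc⟩ | ⟨hc, hu1⟩
      · exact Or.inl ⟨hu1, (lt_div_iff₀ hN).mpr (by linarith [mul_comm (a ^ 2 + b ^ 2) (w 1)])⟩
      · exact Or.inr ⟨(div_lt_iff₀ hN).mpr (by linarith [mul_comm (a ^ 2 + b ^ 2) (w 1)]), hu1⟩
    · rw [hΦ]
      funext i
      fin_cases i
      · simp only [Fin.zero_eta, Fin.isValue, Matrix.cons_val_zero]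
        field_simp
        ring
      · simp

/-- The substitution is injective (it is a bijective affine map of the plane). [folklore] -/
theorem aff_injOn (Φ : (Fin 2 → ℝ) → (Fin 2 → ℝ))
    (hΦ : ∀ w, Φ w = ![((a ^ 2 + b ^ 2) * w 0 - a) / b, w 1]) (hb : 0 < b) (σ : Set (Fin 2 → ℝ)) :
    InjOn Φ σ := by
  have hN : 0 < a ^ 2 + b ^ 2 := by positivity
  intro w _ w' _ h
  obtain ⟨e0, e1⟩ := aff_apply Φ hΦ w
  obtain ⟨e0', e1'⟩ := aff_apply Φ hΦ w'
  have h0 : Φ w 0 = Φ w' 0 := by rw [h]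
  have h1 : Φ w 1 = Φ w' 1 := by rw [h]
  rw [e0, e0'] at h0
  rw [e1, e1'] at h1
  have h0' : (a ^ 2 + b ^ 2) * w 0 - a = (a ^ 2 + b ^ 2) * w' 0 - a := by
    have := congrArg (· * b) h0
    simpa [div_mul_cancel₀ _ hb.ne'] using this
  have hs : w 0 = w' 0 := by
    have : (a ^ 2 + b ^ 2) * w 0 = (a ^ 2 + b ^ 2) * w' 0 := by linarith
    exact mul_left_cancel₀ hN.ne' this
  funext i
  fin_cases i
  exacts [hs, h1]

/-! ## Semialgebraicity -/

/-- The substitution is a `ℚ`-semialgebraic map on every `ℚ`-semialgebraic set: its coordinates are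
polynomials with real-algebraic coefficients. [cite: BochnakCosteRoy1998, §2.2] -/
theorem aff_isSemialgebraicMapOn (Φ : (Fin 2 → ℝ) → (Fin 2 → ℝ))
    (hΦ : ∀ w, Φ w = ![((a ^ 2 + b ^ 2) * w 0 - a) / b, w 1])
    (ha : IsAlgebraic ℚ a) (hb : IsAlgebraic ℚ b) {σ : Set (Fin 2 → ℝ)}
    (hσ : IsSemialgebraic ℚ σ) : IsSemialgebraicMapOn ℚ σ Φ := by
  have s0 : IsSemialgebraicFunOn ℚ σ (fun w => w 0) :=
    (isSemialgebraicFunOn_aeval hσ (X 0)).congr fun w _ => by simp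
  have s1 : IsSemialgebraicFunOn ℚ σ (fun w => w 1) :=
    (isSemialgebraicFunOn_aeval hσ (X 1)).congr fun w _ => by simp
  have hN : IsAlgebraic ℚ (a ^ 2 + b ^ 2) := (ha.pow 2).add (hb.pow 2)
  have sN : IsSemialgebraicFunOn ℚ σ (fun _ => a ^ 2 + b ^ 2) :=
    isSemialgebraicFunOn_const_of_isAlgebraic hσ hN
  have sa : IsSemialgebraicFunOn ℚ σ (fun _ => a) := isSemialgebraicFunOn_const_of_isAlgebraic hσ ha
  have sb : IsSemialgebraicFunOn ℚ σ (fun _ => b⁻¹) :=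
    isSemialgebraicFunOn_const_of_isAlgebraic hσ hb.inv
  have h0 : IsSemialgebraicFunOn ℚ σ (fun w => ((a ^ 2 + b ^ 2) * w 0 - a) / b) :=
    (IsSemialgebraicFunOn.mul_holds (IsSemialgebraicFunOn.sub_holds
      (IsSemialgebraicFunOn.mul_holds sN s0) sa) sb).congr fun w _ => by
        simp only [Pi.mul_apply, Pi.sub_apply, div_eq_mul_inv]
  refine IsSemialgebraicMapOn.of_forall hσ fun j => ?_
  fin_cases j
  · exact h0.congr fun w _ => by simp [(aff_apply Φ hΦ w).1]
  · exact s1.congr fun w _ => by simp [(aff_apply Φ hΦ w).2]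

/-- The parameter-free integrand is a `ℚ`-semialgebraic function on every `ℚ`-semialgebraic
`σ ⊆ {u > 0}`: the semialgebraic sign factor (`sign_isSemialgebraicFunOn`) times `−1`,
divided by the non-vanishing `ℚ`-polynomial `2u(1 + τ²)`. [cite: KontsevichZagier2001, §1.1] -/
theorem affIntegrand_isSemialgebraicFunOn {σ : Set (Fin 2 → ℝ)} (hσ : IsSemialgebraic ℚ σ)
    (hpos : ∀ w ∈ σ, 0 < w 1) : IsSemialgebraicFunOn ℚ σ affIntegrand := by
  have hsign := sign_isSemialgebraicFunOn.mono (subset_univ σ) hσ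
  have hm1 : IsSemialgebraicFunOn ℚ σ (fun _ => (-1 : ℝ)) :=
    (isSemialgebraicFunOn_natCast hσ 1).neg.congr fun w _ => by simp
  have hden : IsSemialgebraicFunOn ℚ σ (fun w => 2 * w 1 * (1 + w 0 ^ 2)) :=
    (isSemialgebraicFunOn_aeval hσ (2 * X 1 * (1 + X 0 ^ 2) : MvPolynomial (Fin 2) ℚ)).congr
      fun w _ => by simp
  have h := (IsSemialgebraicFunOn.mul_holds hsign hm1).div hden fun w hw => by
    have h1 : 0 < w 1 := hpos w hw
    positivity
  exact h.congr fun w _ => by simp only [affIntegrand, Pi.mul_apply]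

/-! ## The derivative -/

/-- The substitution has the constant Fréchet derivative `diag(N/b, 1)`, of determinant `N/b`. [folklore] -/
theorem aff_hasFDerivAt_det (Φ : (Fin 2 → ℝ) → (Fin 2 → ℝ))
    (hΦ : ∀ w, Φ w = ![((a ^ 2 + b ^ 2) * w 0 - a) / b, w 1]) (x : Fin 2 → ℝ) :
    ∃ L : (Fin 2 → ℝ) →L[ℝ] (Fin 2 → ℝ), HasFDerivAt Φ L x ∧ L.det = (a ^ 2 + b ^ 2) / b := by
  set M : Matrix (Fin 2) (Fin 2) ℝ := !![(a ^ 2 + b ^ 2) / b, 0; 0, 1] with hM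
  refine ⟨LinearMap.toContinuousLinearMap (Matrix.toLin' M), ?_, ?_⟩
  · have e0 : HasFDerivAt (fun y : Fin 2 → ℝ => y 0) (ContinuousLinearMap.proj 0) x :=
      hasFDerivAt_apply (𝕜 := ℝ) 0 x
    have e1 : HasFDerivAt (fun y : Fin 2 → ℝ => y 1) (ContinuousLinearMap.proj 1) x :=
      hasFDerivAt_apply (𝕜 := ℝ) 1 x
    have h0 : HasFDerivAt (fun y => Φ y 0)
        ((ContinuousLinearMap.proj 0).comp (LinearMap.toContinuousLinearMap (Matrix.toLin' M)))
        x := by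
      have hf : (fun y => Φ y 0) = fun y : Fin 2 → ℝ => (((a ^ 2 + b ^ 2) / b) * y 0 - a / b) := by
        funext y
        rw [(aff_apply Φ hΦ y).1]
        ring
      rw [hf]
      refine ((e0.const_mul ((a ^ 2 + b ^ 2) / b)).sub_const (a / b)).congr_fderiv
        (ContinuousLinearMap.ext fun u => ?_)
      simp [hM, Matrix.toLin'_apply, dotProduct, Fin.sum_univ_two]
    have h1 : HasFDerivAt (fun y => Φ y 1)
        ((ContinuousLinearMap.proj 1).comp (LinearMap.toContinuousLinearMap (Matrix.toLin' M)))
        x := by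
      have hf : (fun y => Φ y 1) = fun y : Fin 2 → ℝ => y 1 := by
        funext y
        exact (aff_apply Φ hΦ y).2
      rw [hf]
      refine e1.congr_fderiv (ContinuousLinearMap.ext fun u => ?_)
      simp [hM, Matrix.toLin'_apply, dotProduct, Fin.sum_univ_two]
    refine hasFDerivAt_pi'' fun i => ?_
    fin_cases i
    exacts [h0, h1]
  · rw [LinearMap.det_toContinuousLinearMap, LinearMap.det_toLin', Matrix.det_fin_two]
    simp [hM]

/-- **Move data**: a derivative within the ray domain at every point and the Jacobian identity
`sgn(u−1)(−b)/(2u((1−as)²+(bs)²)) = affIntegrand (Φ(s,u)) · |N/b|`, which is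
`N((1 − as)² + (bs)²) = b²(1 + τ²)`. [cite: KontsevichZagier2001, §1.2 rule (2)] -/
theorem aff_moveData (Φ : (Fin 2 → ℝ) → (Fin 2 → ℝ))
    (hΦ : ∀ w, Φ w = ![((a ^ 2 + b ^ 2) * w 0 - a) / b, w 1]) (hb : 0 < b) :
    ∃ Φ' : (Fin 2 → ℝ) → ((Fin 2 → ℝ) →L[ℝ] (Fin 2 → ℝ)), ∀ x ∈ rayDom a b,
      HasFDerivWithinAt Φ (Φ' x) (rayDom a b) x ∧
      rayInt a b x = affIntegrand (Φ x) * |(Φ' x).det| := by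
  choose Φ' hΦ' using aff_hasFDerivAt_det Φ hΦ
  refine ⟨Φ', fun x hx => ?_⟩
  obtain ⟨hL, hdet⟩ := hΦ' x
  refine ⟨hL.hasFDerivWithinAt, ?_⟩
  have hN : 0 < a ^ 2 + b ^ 2 := by positivity
  have hu : 0 < x 1 := pos_of_mem_rayDom hx
  have hQ : 0 < (1 - x 0 * a) ^ 2 + (x 0 * b) ^ 2 := ray_den_pos hb.ne' (x 0)
  obtain ⟨e0, e1⟩ := aff_apply Φ hΦ x
  rw [hdet, abs_of_pos (div_pos hN hb), rayInt, affIntegrand, e0, e1]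
  obtain ⟨σ, hσ⟩ : ∃ σ : ℝ, (if 1 < x 1 then (1 : ℝ) else -1) = σ := ⟨_, rfl⟩
  rw [hσ]
  have hb' : b ≠ 0 := hb.ne'
  have hN' : a ^ 2 + b ^ 2 ≠ 0 := hN.ne'
  have hu' : x 1 ≠ 0 := hu.ne'
  have hQ' : (1 - x 0 * a) ^ 2 + (x 0 * b) ^ 2 ≠ 0 := hQ.ne'
  have key : 1 + (((a ^ 2 + b ^ 2) * x 0 - a) / b) ^ 2 =
      (a ^ 2 + b ^ 2) * ((1 - x 0 * a) ^ 2 + (x 0 * b) ^ 2) / b ^ 2 := by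
    field_simp
    ring
  rw [key]
  generalize hQdef : (1 - x 0 * a) ^ 2 + (x 0 * b) ^ 2 = Q at hQ' ⊢
  field_simp

/-! ## The move -/

/-- **`rayAffine` (NODE g11 P4, first half).** For real algebraic `a`, `b` with `b > 0`: a representation
`[affDomain a b, affIntegrand]` EXISTS (semialgebraic image by Tarski–Seidenberg, glued rational integrand,
integrability by the change-of-variables criterion), and EVERY such representation is KZ-equivalent to Zagier's
ray representation `KZ.rayDilogRep a b` by the single move `Φ(s, u) = ((N s − a)/b, u)` of rule (2).
[cite: KontsevichZagier2001, §1.2 rule (2)] -/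
theorem rayAffine (ha : IsAlgebraic ℚ a) (hb : IsAlgebraic ℚ b) (hb0 : 0 < b)
    (r : KZ.IntegralRep 2) (hr : r.domain = rayDom a b) (hri : EqOn r.integrand (rayInt a b) r.domain) :
    (∃ R : KZ.IntegralRep 2, R.domain = affDomain a b ∧ EqOn R.integrand affIntegrand R.domain) ∧
    (∀ R : KZ.IntegralRep 2, R.domain = affDomain a b → EqOn R.integrand affIntegrand R.domain →
      KZ.Equivalent r R) := by
  obtain ⟨Φ, hΦ⟩ : ∃ Φ : (Fin 2 → ℝ) → (Fin 2 → ℝ),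
      ∀ w, Φ w = ![((a ^ 2 + b ^ 2) * w 0 - a) / b, w 1] := ⟨_, fun _ => rfl⟩
  have himage : Φ '' r.domain = affDomain a b := by
    rw [hr]
    exact aff_image Φ hΦ hb0
  have hΦsa : IsSemialgebraicMapOn ℚ r.domain Φ :=
    aff_isSemialgebraicMapOn Φ hΦ ha hb r.isSemialgebraic_domain
  have hinj : InjOn Φ r.domain := aff_injOn Φ hΦ hb0 _
  obtain ⟨Φ', hΦ'⟩ := aff_moveData (a := a) Φ hΦ hb0
  have hderiv : ∀ x ∈ r.domain, HasFDerivWithinAt Φ (Φ' x) r.domain x := by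
    rw [hr]
    exact fun x hx => (hΦ' x hx).1
  have hjac : ∀ x ∈ r.domain, r.integrand x = affIntegrand (Φ x) * |(Φ' x).det| := by
    intro x hx
    rw [hri hx]
    exact (hΦ' x (hr ▸ hx)).2
  have hmeas : MeasurableSet r.domain := KZ.IntegralRep.measurableSet_domain_holds r
  -- existence
  have hT : IsSemialgebraic ℚ (Φ '' r.domain) :=
    IsSemialgebraicMapOn.isSemialgebraic_image_holds hΦsa subset_rfl r.isSemialgebraic_domain
  have hN : 0 < a ^ 2 + b ^ 2 := by positivity
  have hpos : ∀ w ∈ Φ '' r.domain, 0 < w 1 := by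
    rw [himage]
    rintro w ⟨-, -, ⟨hu1, -⟩ | ⟨hc, -⟩⟩
    · exact zero_lt_one.trans hu1
    · rcases lt_or_ge 0 (w 1) with hlt | hle
      · exact hlt
      · exfalso
        have : (a ^ 2 + b ^ 2) * w 1 ≤ 0 := mul_nonpos_of_nonneg_of_nonpos hN.le hle
        nlinarith [sq_nonneg (a + b * w 0)]
  have hF := affIntegrand_isSemialgebraicFunOn hT hpos
  have hI : IntegrableOn affIntegrand (Φ '' r.domain) := by
    rw [integrableOn_image_iff_integrableOn_abs_det_fderiv_smul volume hmeas hderiv hinj]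
    refine r.integrableOn.congr_fun (fun x hx => ?_) hmeas
    rw [hjac x hx, smul_eq_mul, mul_comm]
  refine ⟨⟨⟨Φ '' r.domain, affIntegrand, hT, hF, hI⟩, himage, fun _ _ => rfl⟩, ?_⟩
  -- every such `R` is one move away
  intro R hR hRi
  refine KZ.changeOfVariablesRel_subset_relations
    ⟨2, r, R, Φ, Φ', hΦsa, hderiv, hinj, hR.trans himage.symm, fun x hx => ?_, rfl⟩
  have hx' : Φ x ∈ R.domain := by
    rw [hR, ← himage]
    exact mem_image_of_mem Φ hx
  rw [hjac x hx, hRi hx']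

/-! ## Rationality inside the closed unit disc -/

/-- On `affDomain a b` with `N = a² + b² ≤ 1` the sheet `u > 1` is empty and `u > 0`. [folklore] -/
theorem affDomain_sheet (hN1 : a ^ 2 + b ^ 2 ≤ 1) (hb : 0 < b) {w : Fin 2 → ℝ} (hw : w ∈ affDomain a b) :
    0 < w 1 ∧ w 1 < 1 := by
  have hN : 0 < a ^ 2 + b ^ 2 := by positivity
  obtain ⟨h0, h1, hsh⟩ := hw
  have hsq : (a + b * w 0) ^ 2 < (a ^ 2 + b ^ 2) ^ 2 := by nlinarith
  have hsq' : (a ^ 2 + b ^ 2) ^ 2 ≤ (a ^ 2 + b ^ 2) * 1 := by nlinarith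
  rcases hsh with ⟨hu1, hc⟩ | ⟨hc, hu1⟩
  · exfalso
    have : (a ^ 2 + b ^ 2) * 1 < (a ^ 2 + b ^ 2) * w 1 := by nlinarith
    nlinarith
  · refine ⟨?_, hu1⟩
    rcases lt_or_ge 0 (w 1) with hlt | hle
    · exact hlt
    · exfalso
      have : (a ^ 2 + b ^ 2) * w 1 ≤ 0 := mul_nonpos_of_nonneg_of_nonpos hN.le hle
      nlinarith [sq_nonneg (a + b * w 0)]

/-- **`isRational_of_affDomain` (NODE g11 P4, second half).** For `a² + b² ≤ 1`, `b > 0`, every representation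
`[affDomain a b, affIntegrand]` has Kontsevich–Zagier's literal rational shape: its integrand agrees on the domain
with `1/(2u(1 + τ²)) = aeval 1 / aeval (2·X₁·(1 + X₀²))`. [cite: KontsevichZagier2001, §1.1 Definition] -/
theorem isRational_of_affDomain (hN1 : a ^ 2 + b ^ 2 ≤ 1) (hb : 0 < b) (R : KZ.IntegralRep 2)
    (hR : R.domain = affDomain a b) (hRi : EqOn R.integrand affIntegrand R.domain) : R.IsRational := by
  refine ⟨1, 2 * X 1 * (1 + X 0 ^ 2), fun x hx => ?_, fun x hx => ?_⟩
  · have hu := (affDomain_sheet hN1 hb (hR ▸ hx)).1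
    simp only [map_mul, map_ofNat, MvPolynomial.aeval_X, map_add, map_one, map_pow]
    positivity
  · have h := affDomain_sheet hN1 hb (hR ▸ hx)
    rw [hRi hx, affIntegrand, if_neg (not_lt.mpr h.2.le)]
    simp only [map_mul, map_ofNat, MvPolynomial.aeval_X, map_add, map_one, map_pow]
    ring

/-- **Corollary (the unit circle, as used for `Z₇`).** For algebraic `a`, `b` with `b > 0` and `a² + b² ≤ 1`
there is a `ℚ`-RATIONAL two-dimensional representation with domain `affDomain a b` and integrand
`affIntegrand`, KZ-equivalent to Zagier's ray representation of `D(a + ib)`. [cite: KontsevichZagier2001, §1.2] -/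
theorem exists_rational_rayRep (ha : IsAlgebraic ℚ a) (hb : IsAlgebraic ℚ b) (hb0 : 0 < b)
    (hN1 : a ^ 2 + b ^ 2 ≤ 1) (r : KZ.IntegralRep 2) (hr : r.domain = rayDom a b)
    (hri : EqOn r.integrand (rayInt a b) r.domain) :
    ∃ R : KZ.IntegralRep 2, R.IsRational ∧ R.domain = affDomain a b ∧
      EqOn R.integrand affIntegrand R.domain ∧ KZ.Equivalent r R := by
  obtain ⟨⟨R, hR, hRi⟩, hall⟩ := rayAffine ha hb hb0 r hr hri
  exact ⟨R, isRational_of_affDomain hN1 hb0 R hR hRi, hR, hRi, hall R hR hRi⟩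

end Summit.KontsevichZagierPeriods.RootDecompQuadraticDescent.RayAffine

end
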